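import Literature.MathematicalPhysics.QuantumFieldTheory.Balaban1983to89.B4Ineq412ConstField
import Literature.MathematicalPhysics.QuantumFieldTheory.Balaban1983to89.B4Eq12ExpFlow

/-!
# `Balaban1983to89.B4Eq48FirstOrder` — T. Bałaban, *Regularity and decay of lattice Green's functions*, Commun. Math.
# Phys. **89** (1983) 571–597 [Balaban1983RegularityDecay], §4 p. 590 [PDF 20]: the display **(4.8)** of the proof of
# Proposition 3.1′ — the displayed three-line expression IS the first-order term (the `t`-derivative at `t = 0` along
# `A = A₀ + tA′`) of the left side of (4.7) `a_k|φ(x)|² + a_k|φ(x′)|² − a_k²⟨φ, Q_k(A)G_k(Δ(x,x′),A)Q_k^*(A)φ⟩`, for the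
# link variables `U(A) = e^{qeηA}` of (1.2) with EVERY antisymmetric `q` — kernel theorems (matrix calculus: `Ġ = −GḢG`,
# the envelope cancellation at `φ^{(k)} = a_kG_kQ_k^*φ`, and «φ·qφ = 0 because q is an antisymmetric matrix»)

statement-level skeleton of published theorems with citation tags; proofs where landed; nothing here is a claim about the Yang–Mills mass gap

PDF held: `paper:balaban1983-cmp89-regularity-decay` (render `run/shared/lean/pub/pub-balaban/b2b-balaban-ref1/pages/
1983-cmp89-regularity-decay/1983-cmp89-regularity-decay-p020-x2.png`, READ AS AN IMAGE — the text layer of (4.8) is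
garbled; journal page = PDF page + 570).

CITATION HEADER (lean-in-tree rule).  lit-balaban cell (HOME `run/shared/lean/pub/lit-balaban/`), block B4 (fold owner
r01), SKELETON row **`B4.Eq4.11`** ((4.8)–(4.13)); companion of `B4Eq49TwoBlockGreen` ((4.9)); the displays
(4.10)–(4.13) are `B4Ineq410GaugeOut` (r01 g4: `qgq`, `lhs47` = the left side of (4.7), USED here by name),
(4.12)/(4.14) `B4Ineq412ConstField` / `B4Ineq414TwoBlock`.  Written by the block's second reader, unit `lit-balaban-r04`
gen 11 (free-target protocol G.5-34(d), TAKING 2026-08-22T03:11Z).  Inputs USED BY NAME: the flow `e^{tq}` of (1.2)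
(`B4Eq12ExpFlow.expFlow`, r01 g5), the covariant operators (1.3)–(1.6) and their gauge covariance
(`B4GaugeCovariance`: `fieldLink`, `bondDiff`, `covLap`, `avgOp`, `b4Op`, `b4Green`, `b4Op_constBond`), the abelian
transporters `U(A(Γ)) = U(κΣ_bA_b)` (`B4Lower18Regular.transport_fieldLink`, `lsum`), «φ·qφ = 0»
(`B4Ineq410GaugeOut.dotProduct_mulVec_self_eq_zero`), (1.8) at `A = 0` on finite unions of blocks
(`B4Lower18.fineOpR_isUnit`) and the zero-field dictionary `B4Ineq412ConstField.scalarOp_fineDom`; Mathlib's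
`hasDerivAt_exp_smul_const'`, `hasFDerivAt_ringInverse`.

## THE PRINT (verbatim, p. 590 [PDF 20])

*"We will transform the left hand side of (4.7). Using the regularity condition for A, we write A = A₀ + A′ on Δ(x,x′)
with A₀ constant and A′ satisfying the bounds |A′|, |∂^η_μA′| ≤ O(1)p(e). We expand the expression on the left hand
side of (4.7) with respect to A′ using (I.3.15), (I.3.44), and we separate terms of first order in e. Using Lemma 2.1
the remaining terms can be easily estimated by O(e²p²(e))(|φ(x)|² + |φ(x′)|²). Now let us consider the terms of first
order. Formally we could rely on the estimates of perturbative expansions in the third paper [3], but there they were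
derived in a different setting, the interaction terms considered on a domain far from the boundary of basic domains for
propagators, so let us repeat this part of the argument. Denoting φ^{(k)} = a_kG_k(Δ(x,x′),A₀)Q_k^*(A₀)φ, we have the
following expression
  2 Σ_{b⊂Δ(x,x′)} [(D^η_{A₀}φ^{(k)})(b)·qφ^{(k)}(b₋)] eA′_b
  + 2a_k Σ_{y=x,x′} (Q_k(A₀)φ^{(k)})(y) · Σ_{z∈B^k(y)} η^d eηA′(Γ^{(k)}_{y,z}) qU(A₀(Γ^{(k)}_{y,z}))φ^{(k)}(z)
  − 2a_k Σ_{y=x,x′} φ(y) · Σ_{z∈B^k(y)} η^d eηA′(Γ^{(k)}_{y,z}) qU(A₀(Γ^{(k)}_{y,z}))φ^{(k)}(z).   (4.8)"*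

Context (verbatim): (4.7) p. 590 «a_k|φ(x)|² + a_k|φ(x′)|² − a_k²⟨φ, Q_k(A)G_k(Δ(x,x′),A)Q_k^*(A)φ⟩ ≥ …»; (1.2) p. 572
«U(A) = e^{qeηA}, q is an antisymmetric N × N matrix, where e is a real parameter»; (1.3) «⟨φ,(−Δ^{η,N}_{A,Ω})φ⟩ =
Σ_{b⊂Ω} η^d|(D^η_Aφ)(b)|² = Σ_{b⊂Ω} η^d|η^{−1}(U(A_b)φ(b₊) − φ(b₋))|²»; (1.4) «(Q_k(A)φ)(y) = Σ_{x∈B^k(y)}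
η^dU(A(Γ^{(k)}_{y,x}))φ(x)»; (1.6) «G_k(Ω,A) = (−Δ^{η,N}_{A,Ω} + m² + aP_k(A))^{−1}»; p. 591 «(φ(x)·qφ(x) = 0 because q
is an antisymmetric matrix)».

## WHAT IS CERTIFIED (kernel theorems; zero `sorry`, standard axioms; no `Prop`-valued statement is introduced)

Everything over the GENERIC carrier of `B4GaugeCovariance`/`B4Ineq410GaugeOut` (finite site set `X`, block labels
`Y`, colours `ι`, bond weights `c`, inner block weights `qin` with coefficient `a` inside `G_k`, outer block weights
`qout` and prefactor `a_k` of (4.7), block embedding `emb`, contour system `Γ`, coupling `κ = eη`), for the flow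
`F = B4Eq12ExpFlow.expFlow q hq` (`U(t) = e^{tq}`, ANY antisymmetric `q`), along the line `A_t = A₀ + tA′`:
* §0 (private plumbing) matrix products / transposes / inverses / quadratic forms / single-block embeddings as continuous
  (bi)linear maps and their `HasDerivAt` rules (`Ġ = −GḢG` from Mathlib's `hasFDerivAt_ringInverse`).
* §1 the derivatives at `t = 0` of every building block, as MATRIX identities: `hasDerivAt_expFlow_affine`
  (`d/dt e^{(s₀+ts₁)q} = s₁qe^{s₀q}`), `hasDerivAt_fieldLink` (`Ẇ_b = κA′_b·q·U(κA₀,b)`), `hasDerivAt_contourTrans`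
  (`Ṫ(y,x) = κA′(Γ_{y,x})·q·U(κA₀(Γ_{y,x}))` = `dT`; the flow is abelian, `lsum_affine`), `hasDerivAt_avgOp` (`Q̇ =
  avgOp q dT`), `hasDerivAt_bondDiff` (`Ḋ = dD`), `hasDerivAt_covLap` (`−Δ̇ = dLap = Σc(D₀ᵀḊ + ḊᵀD₀)`),
  `hasDerivAt_b4Op` (`Ḣ = dH = dLap + a(Q₀ᵀQ̇ + Q̇ᵀQ₀)`), `hasDerivAt_b4Green` (`Ġ = −GḢG` at an invertible `H(A₀)`),
  `hasDerivAt_qgq`, `hasDerivAt_lhs47_raw` (product rule for `a_k|φ|² − a_k²⟨φ,QGQᵀφ⟩`).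
* §2 the algebra: `b4Op_transpose`/`b4Green_transpose` ((1.6) is symmetric), `raw_eq_envelope` (the raw derivative
  `= ⟨φ^{(k)}, Ḣφ^{(k)}⟩ − 2a_k⟨φ, Q̇φ^{(k)}⟩` with `φ^{(k)} = phiK0 = a_k • G(A₀)Q(A₀)ᵀφ` — the terms carrying the derivative
  of the minimiser cancel by the symmetry of `G`), `bondDiff_dot_q` («φ·qφ = 0» ⇒ `(Uφ(y) − φ(x))·q(Uφ(y)) =
  (Uφ(y) − φ(x))·qφ(x)`), `dLap_form` (the first printed line), `dH_form` (first + second lines), and the printed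
  expression **`firstOrder48`** (the three lines of (4.8) in lattice units, inner sums `dAvg`).
* §3 **`hasDerivAt_lhs47`**: for every carrier, every `A₀` at which `H(A₀)` is invertible, every direction `A′` and every
  `φ`: `HasDerivAt (t ↦ lhs47 F κ c m² a qin qout emb Γ a_k (A₀ + t•A′) φ) (firstOrder48 … A₀ A′ φ) 0` — (4.8) IS THE
  FIRST-ORDER TERM of the left side of (4.7).
* §4 **`hasDerivAt_lhs47_fineDom`**: the same, HYPOTHESIS-FREE, on the carrier in which (4.7)/(4.12)/(4.14) are typed
  (`B4Ineq412ConstField.ineq412_constBond_gen`: the fine region of any finite set `Ω` of unit labels — `Δ(x,x′)` is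
  `Ω = pair y₀ μ` — weights `regWt`/`blkWtR`/`outWt`, coefficient `a_k n^{−(d+1)}`, prefactor `a_k`, any block embedding
  and admissible contour system) at a CONSTANT background `A₀ = constBond A₀`, any scale `n ≥ 1`, `a_k > 0`, `m² ≥ 0`:
  the invertibility is `isUnit_b4Op_constBond_fineDom` ((1.8) at `A = 0`, `B4Lower18.fineOpR_isUnit`, transported by
  `B4GaugeCovariance.b4Op_constBond`).

## DICTIONARY (print ↦ Lean)

`e^{qeηA_b}` ↦ `fieldLink (expFlow q hq) κ A u v = exp ((κ·A u v) • q)`, `κ = eη`; `A = A₀ + A′` expanded «with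
respect to A′» ↦ the line `A₀ + t • A′`, first-order term = `HasDerivAt … 0`; `Δ(x,x′)` ↦ the site type `X` (§4: `↥(fineDom
n Ω)`), `y = x, x′` ↦ `Y` (§4: `↥Ω`); `(D^η_{A₀}φ)(b)`, `b = ⟨u,v⟩` ↦ `η^{−1}·(fieldLink … A₀ u v *ᵥ fld φ v − fld φ u)`
(the `η^{−2}` of (1.3) sits in `c`: §4 `regWt = n²/2` per ORIENTED nearest-neighbour pair, both orientations summed);
`U(A₀(Γ^{(k)}_{y,z}))` ↦ `contourTrans (fieldLink … A₀) emb Γ y z = U(κ·lsum A₀ (emb y) (Γ y z))`; `eηA′(Γ^{(k)}_{y,z})` ↦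
`κ * lsum A′ (emb y) (Γ y z)`; `η^d1[z ∈ B^k(y)]` ↦ the block weights (`qin = blkWtR` with the coefficient
`a·n^{−(d+1)}` inside `G_k`; `qout = outWt = n^{−(d+1)/2}blkWtR` and prefactor `a_k = a` in (4.7), r01's normalisation
making `lhs47` literally the printed left side of (4.7)); `φ^{(k)} = a_kG_k(Δ,A₀)Q_k^*(A₀)φ` ↦ `phiK0 = a_k • b4Green … A₀ *ᵥ
(avgOp qout …)ᵀφ` (with `qout = n^{−(d+1)/2}blkWtR` this is `n^{−(d+1)/2}` times the printed `φ^{(k)}`, whose `Q_k^*` is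
the plain blockwise extension — `B4Eq49TwoBlockGreen.phiK_eq_b4Green`); `Σ_{z∈B^k(y)} η^d eηA′(Γ)qU(A₀(Γ))φ(z)` ↦ `dAvg`.

## HONEST SCOPE / located readings

(a) WHAT «first-order term» MEANS HERE: the derivative at `t = 0` of `t ↦ LHS(4.7)(A₀ + tA′)` (a `HasDerivAt`
statement); the print's «we separate terms of first order in e» along `A = A₀ + A′` is this derivative at `A′`
(direction `A′`, `t = 1` formally); the SECOND-order remainder «O(e²p²(e))(|φ(x)|² + |φ(x′)|²)» («Using Lemma 2.1 the
remaining terms can be easily estimated») is NOT estimated here — it stays the hypothesis `hdec`/`hR` of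
`B4Ineq410GaugeOut.ineq411`.
(b) THE MEASURE OF THE FIRST LINE.  With r01's normalisation (`lhs47` = the printed left side of (4.7), `φ` = the
printed block function), `phiK0 = n^{−(d+1)/2}φ^{(k)}_print`, and the certified identity reads, in the print's letters,
`d/dt LHS(4.7) = 2Σ_b η^d[(D^η_{A₀}φ^{(k)})(b)·qφ^{(k)}(b₋)]eA′_b + (second line) − (third line)`: the second and third
lines exactly as displayed, the first line WITH the bond measure `η^d` of (1.3), which the display (4.8) does not
print in its first line (it prints `η^d` in the other two).  Located reading (a harmless elision: (4.10) bounds the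
first line by `O(1)ep(e)|U(A₀(⟨x,x′⟩))φ(x′) − φ(x)|(|φ(x)| + |φ(x′)|)` either way); recorded, not adjudicated — the
row owner decides whether it is a §5 erratum entry.
(c) Both orientations of each bond are summed with `c(u,v)`; for an antisymmetric `A′` and `U(A(v,u)) = U(A(u,v))ᵀ`
the two oriented terms of the first line coincide (orthogonality and `qU = Uq`), giving the print's sum over
unoriented bonds with `η^{−2}`; this bookkeeping is the dictionary's (`regWt = n²/2`), not re-proved here.
(d) `A₀` need not be constant and `A′` need not be small or antisymmetric for §3 (an identity); §4 takes `A₀` constant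
only to discharge invertibility hypothesis-free via (1.8) at `A = 0`; for a general regular `A₀` use (1.8)
(`B4Lower18RegularRegion`) to feed `hasDerivAt_lhs47`.
(e) Nothing of [1]–[3] ((I.3.15), (I.3.44), «the third paper») is used: the expansion is done directly on the
finite-dimensional operators.
No existing module is modified; two `import`s.
-/

namespace Literature.MathematicalPhysics.QuantumFieldTheory.Balaban1983to89.B4Eq48FirstOrder

open scoped Matrix.Norms.Operator
open NormedSpace Matrix Finset
open Literature.MathematicalPhysics.QuantumFieldTheory.Balaban1983to89.B4GaugeCovariance
open Literature.MathematicalPhysics.QuantumFieldTheory.Balaban1983to89.B4Lower18Regular (lsum transport_fieldLink)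
open Literature.MathematicalPhysics.QuantumFieldTheory.Balaban1983to89.B4Ineq410GaugeOut
  (qgq lhs47 lsum_add dotProduct_mulVec_self_eq_zero)
open Literature.MathematicalPhysics.QuantumFieldTheory.Balaban1983to89.B4Eq12ExpFlow (expFlow expFlow_U)

noncomputable section

/-! ## §0. Calculus plumbing: matrix products, transposes, inverses, quadratic forms and block embeddings as
continuous (bi)linear maps, and their derivatives along a real parameter (the `linfty`-operator norm of
`Matrix.Norms.Operator` is used only to state `HasDerivAt` for matrix-valued maps) -/

section Calculus

variable {l m n : Type*} [Fintype l] [Fintype m] [Fintype n]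

/-- rectangular matrix multiplication as a continuous bilinear map. [folklore] -/
private def mulB (l m n : Type*) [Fintype l] [Fintype m] [Fintype n] :
    Matrix l m ℝ →L[ℝ] Matrix m n ℝ →L[ℝ] Matrix l n ℝ :=
  LinearMap.mkContinuous₂ (LinearMap.mk₂ ℝ (fun A B => A * B) (fun A A' B => Matrix.add_mul A A' B)
    (fun c A B => Matrix.smul_mul c A B) (fun A B B' => Matrix.mul_add A B B') (fun c A B => Matrix.mul_smul A c B))
    1 (fun A B => by simpa using Matrix.linfty_opNorm_mul A B)

/-- product rule for matrix-valued maps of a real parameter. [folklore] -/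
private theorem hasDerivAt_matMul {u : ℝ → Matrix l m ℝ} {v : ℝ → Matrix m n ℝ} {u' : Matrix l m ℝ}
    {v' : Matrix m n ℝ} {x : ℝ} (hu : HasDerivAt u u' x) (hv : HasDerivAt v v' x) :
    HasDerivAt (fun t => u t * v t) (u x * v' + u' * v x) x :=
  ContinuousLinearMap.hasDerivAt_of_bilinear (B := mulB l m n) (u := u) (v := v) (fun _ => hu) (fun _ => hv)

/-- transposition as a continuous linear map. [folklore] -/
private def trB (l m : Type*) [Fintype l] [Fintype m] : Matrix l m ℝ →L[ℝ] Matrix m l ℝ :=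
  LinearMap.toContinuousLinearMap (Matrix.transposeLinearEquiv l m ℝ ℝ).toLinearMap

/-- derivative of the transpose. [folklore] -/
private theorem hasDerivAt_tr {M : ℝ → Matrix l m ℝ} {M' : Matrix l m ℝ} {x : ℝ} (h : HasDerivAt M M' x) :
    HasDerivAt (fun t => (M t)ᵀ) M'ᵀ x :=
  (trB l m).hasFDerivAt.comp_hasDerivAt x h

/-- derivative of the matrix inverse at an invertible value: `d/dt H⁻¹ = −H⁻¹ḢH⁻¹`. [folklore] -/
private theorem hasDerivAt_matInv [DecidableEq m] {H : ℝ → Matrix m m ℝ} {H' : Matrix m m ℝ}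
    (hH : HasDerivAt H H' 0) (hU : IsUnit (H 0)) :
    HasDerivAt (fun t => (H t)⁻¹) (-((H 0)⁻¹ * H' * (H 0)⁻¹)) 0 := by
  haveI : CompleteSpace (Matrix m m ℝ) := FiniteDimensional.complete ℝ (Matrix m m ℝ)
  obtain ⟨u, hu⟩ := hU
  have h0 : HasFDerivAt (𝕜 := ℝ) Ring.inverse
      (-((ContinuousLinearMap.mulLeftRight ℝ (Matrix m m ℝ)) ↑u⁻¹) ↑u⁻¹) (H 0) := by
    rw [← hu]; exact hasFDerivAt_ringInverse u
  have h1 := h0.comp_hasDerivAt (0 : ℝ) hH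
  have hfun : (fun t => (H t)⁻¹) = Ring.inverse ∘ H := by
    funext t; simp [Matrix.nonsing_inv_eq_ringInverse]
  rw [hfun]
  refine h1.congr_deriv ?_
  have hinv : (H 0)⁻¹ = ((u⁻¹ : (Matrix m m ℝ)ˣ) : Matrix m m ℝ) := by
    rw [← hu, Matrix.coe_units_inv]
  rw [hinv]
  simp

/-- the quadratic form `M ↦ Ψ·(MΨ)` as a continuous linear functional. [folklore] -/
private def formB (l : Type*) [Fintype l] (Ψ : l → ℝ) : Matrix l l ℝ →L[ℝ] ℝ :=
  LinearMap.toContinuousLinearMap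
    { toFun := fun M => Ψ ⬝ᵥ (M *ᵥ Ψ)
      map_add' := fun A B => by simp only [Matrix.add_mulVec, dotProduct_add]
      map_smul' := fun c A => by simp only [Matrix.smul_mulVec, dotProduct_smul, smul_eq_mul, RingHom.id_apply] }

/-- derivative of `t ↦ Ψ·(M(t)Ψ)`. [folklore] -/
private theorem hasDerivAt_form (Ψ : l → ℝ) {M : ℝ → Matrix l l ℝ} {M' : Matrix l l ℝ} {x : ℝ}
    (h : HasDerivAt M M' x) : HasDerivAt (fun t => Ψ ⬝ᵥ (M t *ᵥ Ψ)) (Ψ ⬝ᵥ (M' *ᵥ Ψ)) x :=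
  (formB l Ψ).hasFDerivAt.comp_hasDerivAt x h

end Calculus

section Blocks

variable {X Y ι : Type*} [Fintype X] [Fintype Y] [Fintype ι] [DecidableEq X] [DecidableEq Y] [DecidableEq ι]

/-- the single-block embedding `M ↦ blockOp (1_{(y₀,x₀)} ⊗ M)` as a continuous linear map. [folklore] -/
private def embB (Y X ι : Type*) [Fintype Y] [Fintype X] [Fintype ι] [DecidableEq Y] [DecidableEq X]
    [DecidableEq ι] (y₀ : Y) (x₀ : X) : Matrix ι ι ℝ →L[ℝ] Matrix (Y × ι) (X × ι) ℝ :=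
  LinearMap.toContinuousLinearMap
    { toFun := fun M => blockOp fun y x => if y = y₀ ∧ x = x₀ then M else 0
      map_add' := fun A B => by
        rw [← blockOp_add]; congr 1; funext y x; simp only [Pi.add_apply]; split_ifs <;> simp
      map_smul' := fun c A => by
        rw [RingHom.id_apply, ← blockOp_smul]; congr 1; funext y x; simp only [Pi.smul_apply]
        split_ifs <;> simp }

/-- unfolding of the single-block embedding. [folklore] -/
private theorem embB_apply (y₀ : Y) (x₀ : X) (M : Matrix ι ι ℝ) :
    embB Y X ι y₀ x₀ M = blockOp fun y x => if y = y₀ ∧ x = x₀ then M else 0 := rfl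

/-- a block operator is the sum of its single-block embeddings. [folklore] -/
private theorem blockOp_eq_sum_embB (K : Y → X → Matrix ι ι ℝ) :
    blockOp K = ∑ y, ∑ x, embB Y X ι y x (K y x) := by
  simp_rw [embB_apply, ← blockOp_sum]
  congr 1
  funext y x
  simp only [Finset.sum_apply]
  rw [Finset.sum_eq_single y, Finset.sum_eq_single x]
  · simp
  · intro x' _ hx'; simp [Ne.symm hx']
  · intro h; exact absurd (Finset.mem_univ _) h
  · intro y' _ hy'
    rw [Finset.sum_eq_zero]; intro x' _; simp [Ne.symm hy']
  · intro h; exact absurd (Finset.mem_univ _) h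

/-- derivative of a block operator whose blocks are differentiable. [folklore] -/
private theorem hasDerivAt_blockOp {K : ℝ → Y → X → Matrix ι ι ℝ} {K' : Y → X → Matrix ι ι ℝ} {t₀ : ℝ}
    (h : ∀ y x, HasDerivAt (fun t => K t y x) (K' y x) t₀) :
    HasDerivAt (fun t => blockOp (K t)) (blockOp K') t₀ := by
  simp_rw [blockOp_eq_sum_embB]
  refine HasDerivAt.fun_sum fun y _ => HasDerivAt.fun_sum fun x _ => ?_
  exact (embB Y X ι y x).hasFDerivAt.comp_hasDerivAt t₀ (h y x)

end Blocks

/-! ## §1. The abelian flow `U(t) = e^{tq}` of (1.2) along an affine argument, and the derivatives of the link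
variables `U(κ(A₀ + tA′)_b)`, the transporters `U(κ(A₀ + tA′)(Γ))`, the averaging operators `Q_k(A₀ + tA′)`, the
operator `H(A₀ + tA′) = −Δ + m² + aP_k` of (1.6), its Green's function, and the left side of (4.7) -/

section Flow

variable {ι : Type*} [Fintype ι] [DecidableEq ι]

/-- `d/dt|₀ e^{(s₀ + t s₁)q} = s₁·q·e^{s₀q}`. [cite: Balaban1983RegularityDecay, (1.2) p.572] -/
theorem hasDerivAt_expFlow_affine (q : Matrix ι ι ℝ) (hq : qᵀ = -q) (s₀ s₁ : ℝ) :
    HasDerivAt (fun t : ℝ => (expFlow q hq).U (s₀ + t * s₁)) (s₁ • (q * (expFlow q hq).U s₀)) 0 := by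
  haveI : CompleteSpace (Matrix ι ι ℝ) := FiniteDimensional.complete ℝ (Matrix ι ι ℝ)
  simp only [expFlow_U]
  have h1 : HasDerivAt (fun t : ℝ => s₀ + t * s₁) s₁ 0 := by
    simpa using ((hasDerivAt_id (0 : ℝ)).mul_const s₁).const_add s₀
  have h2 : HasDerivAt (fun u : ℝ => exp (u • q)) (q * exp (s₀ • q)) (s₀ + 0 * s₁) := by
    rw [zero_mul, add_zero]; exact hasDerivAt_exp_smul_const' (𝕂 := ℝ) q s₀
  exact h2.scomp 0 h1

end Flow

section Derivatives

variable {X Y ι : Type*} [Fintype X] [Fintype Y] [Fintype ι] [DecidableEq X] [DecidableEq Y] [DecidableEq ι]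

omit [Fintype X] [DecidableEq X] in
/-- `A(Γ)` is homogeneous in the field: `(tA)(Γ) = t·A(Γ)`. [cite: Balaban1983RegularityDecay, p.572 «A(Γ) = Σ_{b⊂Γ} A_b»] -/
theorem lsum_smul (t : ℝ) (A : X → X → ℝ) (x : X) (l : List X) : lsum (t • A) x l = t * lsum A x l := by
  induction l generalizing x with
  | nil => simp [lsum]
  | cons y l ih => simp only [lsum, ih, Pi.smul_apply, smul_eq_mul]; ring

omit [Fintype X] [DecidableEq X] in
/-- `(A₀ + tA′)(Γ) = A₀(Γ) + t·A′(Γ)`. [cite: Balaban1983RegularityDecay, p.572 «A(Γ) = Σ_{b⊂Γ} A_b», p.590 «A = A₀ + A′»] -/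
theorem lsum_affine (A₀ A' : X → X → ℝ) (t : ℝ) (x : X) (l : List X) :
    lsum (A₀ + t • A') x l = lsum A₀ x l + t * lsum A' x l := by
  rw [lsum_add, lsum_smul]

variable (q : Matrix ι ι ℝ) (hq : qᵀ = -q) (κ : ℝ)

omit [Fintype X] [DecidableEq X] in
/-- **`Ẇ`**: the derivative of the link variable `U(κ(A₀ + tA′)_b) = e^{qκ(A₀+tA′)_b}` at `t = 0` is
`κA′_b·q·U(κA₀,b)`. [cite: Balaban1983RegularityDecay, (1.2) p.572, p.590 «we expand … with respect to A′»] -/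
theorem hasDerivAt_fieldLink (A₀ A' : X → X → ℝ) (x y : X) :
    HasDerivAt (fun t : ℝ => fieldLink (expFlow q hq) κ (A₀ + t • A') x y)
      ((κ * A' x y) • (q * fieldLink (expFlow q hq) κ A₀ x y)) 0 := by
  have h := hasDerivAt_expFlow_affine q hq (κ * A₀ x y) (κ * A' x y)
  have hf : (fun t : ℝ => fieldLink (expFlow q hq) κ (A₀ + t • A') x y)
      = fun t => (expFlow q hq).U (κ * A₀ x y + t * (κ * A' x y)) := by
    funext t
    simp only [fieldLink, Pi.add_apply, Pi.smul_apply, smul_eq_mul]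
    ring_nf
  rw [hf]
  exact h

/-- **`Ṫ`**: the derivative at `t = 0` of the transporter `U((A₀ + tA′)(Γ_{y,x}))` along the contour `Γ_{y,x}`:
`κA′(Γ_{y,x})·q·U(κA₀(Γ_{y,x}))` (the flow is abelian, `U(A(Γ)) = U(κΣ_bA_b)`).
[cite: Balaban1983RegularityDecay, (1.4) p.572, (4.8) p.590 «η^d eηA′(Γ^{(k)}_{y,z}) qU(A₀(Γ^{(k)}_{y,z}))»] -/
def dT (emb : Y → X) (Γ : Y → X → List X) (A₀ A' : X → X → ℝ) : Y → X → Matrix ι ι ℝ :=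
  fun y x => (κ * lsum A' (emb y) (Γ y x)) • (q * contourTrans (fieldLink (expFlow q hq) κ A₀) emb Γ y x)

omit [Fintype X] [Fintype Y] [DecidableEq X] [DecidableEq Y] in
/-- the derivative of the transporters is `dT`. [cite: Balaban1983RegularityDecay, (1.4) p.572, (4.8) p.590] -/
theorem hasDerivAt_contourTrans (emb : Y → X) (Γ : Y → X → List X) (A₀ A' : X → X → ℝ) (y : Y) (x : X) :
    HasDerivAt (fun t : ℝ => contourTrans (fieldLink (expFlow q hq) κ (A₀ + t • A')) emb Γ y x)
      (dT q hq κ emb Γ A₀ A' y x) 0 := by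
  have h := hasDerivAt_expFlow_affine q hq (κ * lsum A₀ (emb y) (Γ y x)) (κ * lsum A' (emb y) (Γ y x))
  have hf : (fun t : ℝ => contourTrans (fieldLink (expFlow q hq) κ (A₀ + t • A')) emb Γ y x)
      = fun t => (expFlow q hq).U (κ * lsum A₀ (emb y) (Γ y x) + t * (κ * lsum A' (emb y) (Γ y x))) := by
    funext t
    simp only [contourTrans, transport_fieldLink, lsum_affine]
    ring_nf
  have hT : contourTrans (fieldLink (expFlow q hq) κ A₀) emb Γ y x = (expFlow q hq).U (κ * lsum A₀ (emb y) (Γ y x)) := by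
    simp only [contourTrans, transport_fieldLink]
  rw [hf, dT, hT]
  exact h

/-- **`Q̇`**: the derivative of the averaging operator `Q_k(A₀ + tA′)` (1.4) with block weights `qw` is the block
operator with kernel `qw(y,x)·Ṫ(y,x)`. [cite: Balaban1983RegularityDecay, (1.4) p.572, (4.8) p.590] -/
theorem hasDerivAt_avgOp (qw : Y → X → ℝ) (emb : Y → X) (Γ : Y → X → List X) (A₀ A' : X → X → ℝ) :
    HasDerivAt (fun t : ℝ => avgOp qw (contourTrans (fieldLink (expFlow q hq) κ (A₀ + t • A')) emb Γ))
      (avgOp qw (dT q hq κ emb Γ A₀ A')) 0 := by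
  unfold avgOp
  exact hasDerivAt_blockOp fun y x => (hasDerivAt_contourTrans q hq κ emb Γ A₀ A' y x).const_smul (qw y x)

/-- **`Ḋ`**: the derivative of the covariant bond difference `U(A_b)φ(b₊) − φ(b₋)` (1.3) in the field: the block
operator carrying `Ẇ(x,y) = κA′(x,y)·q·U(κA₀(x,y))` at the site `y = b₊`. [cite: Balaban1983RegularityDecay, (1.3) p.572, (4.8) p.590] -/
def dD (A₀ A' : X → X → ℝ) (x y : X) : Matrix (Unit × ι) (X × ι) ℝ :=
  blockOp fun (_ : Unit) z => if z = y then (κ * A' x y) • (q * fieldLink (expFlow q hq) κ A₀ x y) else 0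

/-- the derivative of the bond difference is `dD`. [cite: Balaban1983RegularityDecay, (1.3) p.572, (4.8) p.590] -/
theorem hasDerivAt_bondDiff (A₀ A' : X → X → ℝ) (x y : X) :
    HasDerivAt (fun t : ℝ => bondDiff (fieldLink (expFlow q hq) κ (A₀ + t • A')) x y) (dD q hq κ A₀ A' x y) 0 := by
  unfold bondDiff dD
  refine hasDerivAt_blockOp fun _ z => ?_
  by_cases hz : z = y
  · simp only [hz, if_true]
    exact (hasDerivAt_fieldLink q hq κ A₀ A' x y).sub_const _
  · simp only [hz, if_false]
    exact hasDerivAt_const (0 : ℝ) _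

/-- **`−Δ̇`**: the derivative of the covariant Laplacian (1.3) in the field at `A₀` in the direction `A′`:
`Σ_{x,y} c(x,y)·(D₀ᵀḊ + ḊᵀD₀)`, `D₀ = D_{xy}(A₀)`. [cite: Balaban1983RegularityDecay, (1.3) p.572, (4.8) p.590 (first line)] -/
def dLap (c : X → X → ℝ) (A₀ A' : X → X → ℝ) : Matrix (X × ι) (X × ι) ℝ :=
  ∑ x, ∑ y, c x y • ((bondDiff (fieldLink (expFlow q hq) κ A₀) x y)ᵀ * dD q hq κ A₀ A' x y
    + (dD q hq κ A₀ A' x y)ᵀ * bondDiff (fieldLink (expFlow q hq) κ A₀) x y)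

/-- the derivative of the covariant Laplacian is `dLap`. [cite: Balaban1983RegularityDecay, (1.3) p.572, (4.8) p.590] -/
theorem hasDerivAt_covLap (c : X → X → ℝ) (A₀ A' : X → X → ℝ) :
    HasDerivAt (fun t : ℝ => covLap c (fieldLink (expFlow q hq) κ (A₀ + t • A'))) (dLap q hq κ c A₀ A') 0 := by
  unfold covLap dLap
  refine HasDerivAt.fun_sum fun x _ => HasDerivAt.fun_sum fun y _ => ?_
  have hD := hasDerivAt_bondDiff q hq κ A₀ A' x y
  have h := (hasDerivAt_matMul (hasDerivAt_tr hD) hD).const_smul (c x y)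
  refine h.congr_deriv ?_
  simp only [zero_smul, add_zero]

/-- **`Ḣ`**: the derivative of the operator `H(A) = −Δ_A + m² + aQ_k(A)^*Q_k(A)` of (1.6) at `A₀` in the direction
`A′`: `Ḣ = −Δ̇ + a(Q₀ᵀQ̇ + Q̇ᵀQ₀)`. [cite: Balaban1983RegularityDecay, (1.6) p.572, (4.8) p.590] -/
def dH (c : X → X → ℝ) (a : ℝ) (qin : Y → X → ℝ) (emb : Y → X) (Γ : Y → X → List X)
    (A₀ A' : X → X → ℝ) : Matrix (X × ι) (X × ι) ℝ :=
  dLap q hq κ c A₀ A'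
    + a • ((avgOp qin (contourTrans (fieldLink (expFlow q hq) κ A₀) emb Γ))ᵀ * avgOp qin (dT q hq κ emb Γ A₀ A')
        + (avgOp qin (dT q hq κ emb Γ A₀ A'))ᵀ * avgOp qin (contourTrans (fieldLink (expFlow q hq) κ A₀) emb Γ))

/-- the derivative of [B4]'s operator (1.6) along `A₀ + tA′` is `dH`. [cite: Balaban1983RegularityDecay, (1.6) p.572, (4.8) p.590] -/
theorem hasDerivAt_b4Op (c : X → X → ℝ) (m2 a : ℝ) (qin : Y → X → ℝ) (emb : Y → X) (Γ : Y → X → List X)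
    (A₀ A' : X → X → ℝ) :
    HasDerivAt (fun t : ℝ => b4Op (expFlow q hq) κ c m2 a qin emb Γ (A₀ + t • A'))
      (dH q hq κ c a qin emb Γ A₀ A') 0 := by
  unfold b4Op covOp projOp dH
  have h1 := hasDerivAt_covLap q hq κ c A₀ A'
  have h2 : HasDerivAt (fun _ : ℝ => m2 • (1 : Matrix (X × ι) (X × ι) ℝ)) 0 0 := hasDerivAt_const _ _
  have hQ := hasDerivAt_avgOp q hq κ qin emb Γ A₀ A'
  have h3 := (hasDerivAt_matMul (hasDerivAt_tr hQ) hQ).const_smul a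
  have h := (h1.add h2).add h3
  refine h.congr_deriv ?_
  simp only [zero_smul, add_zero]

/-- **`Ġ = −GḢG`**: the derivative of the Green's function (1.6) along `A₀ + tA′`, at an invertible `H(A₀)`.
[cite: Balaban1983RegularityDecay, (1.6) p.572, p.590 «we expand the expression … with respect to A′»] -/
theorem hasDerivAt_b4Green (c : X → X → ℝ) (m2 a : ℝ) (qin : Y → X → ℝ) (emb : Y → X) (Γ : Y → X → List X)
    (A₀ A' : X → X → ℝ) (hU : IsUnit (b4Op (expFlow q hq) κ c m2 a qin emb Γ A₀)) :
    HasDerivAt (fun t : ℝ => b4Green (expFlow q hq) κ c m2 a qin emb Γ (A₀ + t • A'))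
      (-(b4Green (expFlow q hq) κ c m2 a qin emb Γ A₀ * dH q hq κ c a qin emb Γ A₀ A'
          * b4Green (expFlow q hq) κ c m2 a qin emb Γ A₀)) 0 := by
  unfold b4Green
  have hH := hasDerivAt_b4Op q hq κ c m2 a qin emb Γ A₀ A'
  have hU' : IsUnit ((fun t : ℝ => b4Op (expFlow q hq) κ c m2 a qin emb Γ (A₀ + t • A')) 0) := by
    simpa only [zero_smul, add_zero] using hU
  have h := hasDerivAt_matInv hH hU'
  refine h.congr_deriv ?_
  simp only [zero_smul, add_zero]

/-- the derivative of the sandwich `Q_k(A)G_k(Δ,A)Q_k^*(A)` of (4.7) along `A₀ + tA′` (product rule with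
`Ġ = −GḢG`). [cite: Balaban1983RegularityDecay, (4.7)–(4.8) p.590] -/
theorem hasDerivAt_qgq (c : X → X → ℝ) (m2 a : ℝ) (qin qout : Y → X → ℝ) (emb : Y → X)
    (Γ : Y → X → List X) (A₀ A' : X → X → ℝ) (hU : IsUnit (b4Op (expFlow q hq) κ c m2 a qin emb Γ A₀)) :
    HasDerivAt (fun t : ℝ => qgq (expFlow q hq) κ c m2 a qin qout emb Γ (A₀ + t • A'))
      (avgOp qout (contourTrans (fieldLink (expFlow q hq) κ A₀) emb Γ)
          * b4Green (expFlow q hq) κ c m2 a qin emb Γ A₀ * (avgOp qout (dT q hq κ emb Γ A₀ A'))ᵀ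
        + (avgOp qout (contourTrans (fieldLink (expFlow q hq) κ A₀) emb Γ)
              * (-(b4Green (expFlow q hq) κ c m2 a qin emb Γ A₀ * dH q hq κ c a qin emb Γ A₀ A'
                    * b4Green (expFlow q hq) κ c m2 a qin emb Γ A₀))
            + avgOp qout (dT q hq κ emb Γ A₀ A') * b4Green (expFlow q hq) κ c m2 a qin emb Γ A₀)
          * (avgOp qout (contourTrans (fieldLink (expFlow q hq) κ A₀) emb Γ))ᵀ) 0 := by
  unfold qgq
  have hQ := hasDerivAt_avgOp q hq κ qout emb Γ A₀ A'
  have hG := hasDerivAt_b4Green q hq κ c m2 a qin emb Γ A₀ A' hU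
  have h := hasDerivAt_matMul (hasDerivAt_matMul hQ hG) (hasDerivAt_tr hQ)
  refine h.congr_deriv ?_
  simp only [zero_smul, add_zero]

/-- **THE RAW DERIVATIVE OF THE LEFT SIDE OF (4.7)** along `A₀ + tA′` at `t = 0`:
`d/dt [a_k|φ|² − a_k²⟨φ, Q_kG_kQ_k^*φ⟩] = −a_k²·⟨φ, (Q̇GQᵀ + Q(−GḢG)Qᵀ + QGQ̇ᵀ)φ⟩` (before the identification with the
printed (4.8), §2). [cite: Balaban1983RegularityDecay, (4.7)–(4.8) p.590] -/
theorem hasDerivAt_lhs47_raw (c : X → X → ℝ) (m2 a : ℝ) (qin qout : Y → X → ℝ) (emb : Y → X)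
    (Γ : Y → X → List X) (ak : ℝ) (A₀ A' : X → X → ℝ) (Ψ : Y × ι → ℝ)
    (hU : IsUnit (b4Op (expFlow q hq) κ c m2 a qin emb Γ A₀)) :
    HasDerivAt (fun t : ℝ => lhs47 (expFlow q hq) κ c m2 a qin qout emb Γ ak (A₀ + t • A') Ψ)
      (-(ak ^ 2 * (Ψ ⬝ᵥ ((avgOp qout (contourTrans (fieldLink (expFlow q hq) κ A₀) emb Γ)
          * b4Green (expFlow q hq) κ c m2 a qin emb Γ A₀ * (avgOp qout (dT q hq κ emb Γ A₀ A'))ᵀ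
        + (avgOp qout (contourTrans (fieldLink (expFlow q hq) κ A₀) emb Γ)
              * (-(b4Green (expFlow q hq) κ c m2 a qin emb Γ A₀ * dH q hq κ c a qin emb Γ A₀ A'
                    * b4Green (expFlow q hq) κ c m2 a qin emb Γ A₀))
            + avgOp qout (dT q hq κ emb Γ A₀ A') * b4Green (expFlow q hq) κ c m2 a qin emb Γ A₀)
          * (avgOp qout (contourTrans (fieldLink (expFlow q hq) κ A₀) emb Γ))ᵀ) *ᵥ Ψ)))) 0 := by
  unfold lhs47
  have h := ((hasDerivAt_form Ψ (hasDerivAt_qgq q hq κ c m2 a qin qout emb Γ A₀ A' hU)).const_mul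
    (ak ^ 2)).const_sub (ak * (Ψ ⬝ᵥ Ψ))
  exact h

end Derivatives

/-! ## §2. From the raw derivative to the printed expression (4.8): the minimiser identity `H(A₀)φ^{(k)} =
a_kQ_k^*(A₀)φ`-free algebra (only `Gᵀ = G`), the antisymmetry `φ·qφ = 0`, and the block structure of `−Δ̇`, `Q̇` -/

section Algebra

variable {X Y ι : Type*} [Fintype X] [Fintype Y] [Fintype ι] [DecidableEq X] [DecidableEq Y] [DecidableEq ι]

omit [Fintype X] [DecidableEq X] [DecidableEq Y] [DecidableEq ι] in
/-- `⟨Φ, Φ′⟩ = Σ_y φ(y)·φ′(y)`. [folklore] -/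
private theorem dotProduct_eq_sum_fld (Φ Φ' : Y × ι → ℝ) : Φ ⬝ᵥ Φ' = ∑ y, fld Φ y ⬝ᵥ fld Φ' y := by
  simp only [dotProduct, fld, Fintype.sum_prod_type]

omit [DecidableEq X] [DecidableEq Y] [DecidableEq ι] in
/-- `⟨Ψ, (QMRᵀ)Ψ⟩ = ⟨QᵀΨ, M RᵀΨ⟩`. [folklore] -/
private theorem sandwich (Q R : Matrix (Y × ι) (X × ι) ℝ) (M : Matrix (X × ι) (X × ι) ℝ) (Ψ : Y × ι → ℝ) :
    Ψ ⬝ᵥ ((Q * M * Rᵀ) *ᵥ Ψ) = (Qᵀ *ᵥ Ψ) ⬝ᵥ (M *ᵥ (Rᵀ *ᵥ Ψ)) := by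
  rw [← Matrix.mulVec_mulVec, ← Matrix.mulVec_mulVec, Matrix.dotProduct_mulVec, ← Matrix.mulVec_transpose]

omit [DecidableEq X] [DecidableEq ι] in
/-- for a symmetric `M`: `⟨u, Mw⟩ = ⟨w, Mu⟩`. [folklore] -/
private theorem dotProduct_mulVec_of_symm {M : Matrix (X × ι) (X × ι) ℝ} (hM : Mᵀ = M)
    (u w : X × ι → ℝ) : u ⬝ᵥ (M *ᵥ w) = w ⬝ᵥ (M *ᵥ u) := by
  rw [Matrix.dotProduct_mulVec, ← Matrix.mulVec_transpose, hM, dotProduct_comm]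

omit [DecidableEq X] [DecidableEq Y] [DecidableEq ι] in
/-- `⟨ψ, (QᵀR)ψ⟩ = ⟨Qψ, Rψ⟩`. [folklore] -/
private theorem dotProduct_transpose_mul_mulVec (Q R : Matrix (Y × ι) (X × ι) ℝ) (ψ : X × ι → ℝ) :
    ψ ⬝ᵥ ((Qᵀ * R) *ᵥ ψ) = (Q *ᵥ ψ) ⬝ᵥ (R *ᵥ ψ) := by
  rw [← Matrix.mulVec_mulVec, Matrix.dotProduct_mulVec, Matrix.vecMul_transpose]

variable (q : Matrix ι ι ℝ) (hq : qᵀ = -q) (κ : ℝ)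

/-- **`φ^{(k)} = a_kG_k(Δ, A₀)Q_k^*(A₀)φ`** (p. 590) in the covariant vocabulary of `B4GaugeCovariance` /
`B4Ineq410GaugeOut`: `a_k • G(A₀)·Q(A₀)ᵀΨ` (outer block weights `qout`, the ones of `lhs47`).
[cite: Balaban1983RegularityDecay, p.590 «Denoting φ^{(k)} = a_kG_k(Δ(x,x′),A₀)Q_k^*(A₀)φ»] -/
def phiK0 (c : X → X → ℝ) (m2 a : ℝ) (qin qout : Y → X → ℝ) (emb : Y → X) (Γ : Y → X → List X) (ak : ℝ)
    (A₀ : X → X → ℝ) (Ψ : Y × ι → ℝ) : X × ι → ℝ :=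
  ak • (b4Green (expFlow q hq) κ c m2 a qin emb Γ A₀
    *ᵥ ((avgOp qout (contourTrans (fieldLink (expFlow q hq) κ A₀) emb Γ))ᵀ *ᵥ Ψ))

/-- **THE INNER SUM OF THE SECOND AND THIRD LINES OF (4.8)**: `Σ_{z∈B^k(y)} q(y,z)·eηA′(Γ^{(k)}_{y,z})·
qU(A₀(Γ^{(k)}_{y,z}))φ(z)` with block weights `qw` (print: `q(y,z) = η^d1[z ∈ B^k(y)]`, `eη = κ`).
[cite: Balaban1983RegularityDecay, (4.8) p.590] -/
def dAvg (qw : Y → X → ℝ) (emb : Y → X) (Γ : Y → X → List X) (A₀ A' : X → X → ℝ) (φ : X × ι → ℝ) (y : Y) :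
    ι → ℝ :=
  ∑ x, (qw y x * (κ * lsum A' (emb y) (Γ y x)))
    • (q *ᵥ (contourTrans (fieldLink (expFlow q hq) κ A₀) emb Γ y x *ᵥ fld φ x))

omit [Fintype Y] [DecidableEq X] [DecidableEq Y] in
/-- the block form of `Q̇`: `(Q̇φ)(y) = Σ_z q(y,z)κA′(Γ_{y,z})·qU(A₀(Γ_{y,z}))φ(z)`. [cite: Balaban1983RegularityDecay, (4.8) p.590] -/
theorem fld_avgOp_dT_mulVec (qw : Y → X → ℝ) (emb : Y → X) (Γ : Y → X → List X) (A₀ A' : X → X → ℝ)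
    (φ : X × ι → ℝ) (y : Y) :
    fld (avgOp qw (dT q hq κ emb Γ A₀ A') *ᵥ φ) y = dAvg q hq κ qw emb Γ A₀ A' φ y := by
  rw [fld_avgOp_mulVec]
  unfold dAvg dT
  refine Finset.sum_congr rfl fun x _ => ?_
  rw [Matrix.smul_mulVec, smul_smul, Matrix.mulVec_mulVec]

omit [Fintype X] [DecidableEq ι] in
/-- the derivative of the bond difference acts by `(Ḋφ) = κA′(x,y)·q·U(κA₀(x,y))φ(y)`. [folklore] -/
private theorem fld_dD_mulVec [Fintype X] [DecidableEq ι] (A₀ A' : X → X → ℝ) (x y : X) (φ : X × ι → ℝ)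
    (u : Unit) :
    fld (dD q hq κ A₀ A' x y *ᵥ φ) u
      = (κ * A' x y) • (q *ᵥ (fieldLink (expFlow q hq) κ A₀ x y *ᵥ fld φ y)) := by
  unfold dD
  rw [fld_blockOp_mulVec, Finset.sum_eq_single y]
  · rw [if_pos rfl, Matrix.smul_mulVec, Matrix.mulVec_mulVec]
  · intro z _ hz; rw [if_neg hz, Matrix.zero_mulVec]
  · intro h; exact absurd (Finset.mem_univ y) h

omit [Fintype X] [Fintype Y] [DecidableEq X] [DecidableEq Y] [DecidableEq ι] in
/-- vectors indexed by `Unit × ι` pair through their single site. [folklore] -/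
private theorem dotProduct_unit (u v : Unit × ι → ℝ) : u ⬝ᵥ v = fld u () ⬝ᵥ fld v () := by
  simp only [dotProduct, fld, Fintype.sum_prod_type, Finset.univ_unique, PUnit.default_eq_unit,
    Finset.sum_singleton]

include hq in
omit [DecidableEq ι] in
/-- **«φ·qφ = 0 because q is an antisymmetric matrix»** applied to the bond difference:
`(Uφ(y) − φ(x))·q(Uφ(y)) = (Uφ(y) − φ(x))·qφ(x)`. [cite: Balaban1983RegularityDecay, (4.10) p.591, (4.8) p.590] -/
theorem bondDiff_dot_q (U : Matrix ι ι ℝ) (vx vy : ι → ℝ) :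
    (U *ᵥ vy - vx) ⬝ᵥ (q *ᵥ (U *ᵥ vy)) = (U *ᵥ vy - vx) ⬝ᵥ (q *ᵥ vx) := by
  have h0 := dotProduct_mulVec_self_eq_zero hq (U *ᵥ vy - vx)
  rw [Matrix.mulVec_sub, dotProduct_sub] at h0
  linarith

/-- **THE FIRST LINE OF (4.8)** is the quadratic form of `−Δ̇`: `⟨ψ, −Δ̇ψ⟩ = 2κΣ_{x,y} c(x,y)A′(x,y)·
(U(A₀,xy)ψ(y) − ψ(x))·qψ(x)` — print: «2Σ_{b⊂Δ(x,x′)} [(D^η_{A₀}φ^{(k)})(b)·qφ^{(k)}(b₋)]eA′_b».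
[cite: Balaban1983RegularityDecay, (4.8) p.590 (first line), (1.3) p.572] -/
theorem dLap_form (c : X → X → ℝ) (A₀ A' : X → X → ℝ) (ψ : X × ι → ℝ) :
    ψ ⬝ᵥ (dLap q hq κ c A₀ A' *ᵥ ψ)
      = 2 * ∑ x, ∑ y, c x y * (κ * A' x y)
          * ((fieldLink (expFlow q hq) κ A₀ x y *ᵥ fld ψ y - fld ψ x) ⬝ᵥ (q *ᵥ fld ψ x)) := by
  unfold dLap
  rw [Matrix.sum_mulVec, dotProduct_sum, Finset.mul_sum]
  refine Finset.sum_congr rfl fun x _ => ?_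
  rw [Matrix.sum_mulVec, dotProduct_sum, Finset.mul_sum]
  refine Finset.sum_congr rfl fun y _ => ?_
  rw [Matrix.smul_mulVec, dotProduct_smul, smul_eq_mul, Matrix.add_mulVec, dotProduct_add,
    dotProduct_transpose_mul_mulVec, dotProduct_transpose_mul_mulVec, dotProduct_comm (dD q hq κ A₀ A' x y *ᵥ ψ),
    dotProduct_unit, fld_bondDiff_mulVec, fld_dD_mulVec, dotProduct_smul, smul_eq_mul, bondDiff_dot_q q hq]
  ring

omit [DecidableEq Y] in
/-- **THE QUADRATIC FORM OF `Ḣ` AT `ψ`** = first line of (4.8) + `2a⟨Q_k(A₀)ψ, Q̇ψ⟩` (second line).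
[cite: Balaban1983RegularityDecay, (4.8) p.590 (first two lines)] -/
theorem dH_form (c : X → X → ℝ) (a : ℝ) (qin : Y → X → ℝ) (emb : Y → X) (Γ : Y → X → List X)
    (A₀ A' : X → X → ℝ) (ψ : X × ι → ℝ) :
    ψ ⬝ᵥ (dH q hq κ c a qin emb Γ A₀ A' *ᵥ ψ)
      = 2 * ∑ x, ∑ y, c x y * (κ * A' x y)
          * ((fieldLink (expFlow q hq) κ A₀ x y *ᵥ fld ψ y - fld ψ x) ⬝ᵥ (q *ᵥ fld ψ x))
        + 2 * a * ∑ y, fld (avgOp qin (contourTrans (fieldLink (expFlow q hq) κ A₀) emb Γ) *ᵥ ψ) y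
            ⬝ᵥ dAvg q hq κ qin emb Γ A₀ A' ψ y := by
  unfold dH
  rw [Matrix.add_mulVec, dotProduct_add, dLap_form q hq, Matrix.smul_mulVec, dotProduct_smul, smul_eq_mul,
    Matrix.add_mulVec, dotProduct_add, dotProduct_transpose_mul_mulVec, dotProduct_transpose_mul_mulVec,
    dotProduct_comm (avgOp qin (dT q hq κ emb Γ A₀ A') *ᵥ ψ), ← two_mul, dotProduct_eq_sum_fld]
  simp_rw [fld_avgOp_dT_mulVec q hq]
  ring

/-- **THE PRINTED EXPRESSION (4.8)** (p. 590) for the first-order term of the left side of (4.7), in the lattice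
units of `B4GaugeCovariance` (`κ = eη`; bond weights `c`; inner/outer block weights `qin`/`qout`; `φ^{(k)}` =
`phiK0`):
`2Σ_{x,y} c(x,y)κA′(x,y)[(U(A₀,xy)φ^{(k)}(y) − φ^{(k)}(x))·qφ^{(k)}(x)]`  («2Σ_b[(D^η_{A₀}φ^{(k)})(b)·qφ^{(k)}(b₋)]eA′_b»)
`+ 2aΣ_y (Q_k(A₀)φ^{(k)})(y)·Σ_z qin(y,z)κA′(Γ_{y,z})qU(A₀(Γ_{y,z}))φ^{(k)}(z)`
`− 2a_kΣ_y φ(y)·Σ_z qout(y,z)κA′(Γ_{y,z})qU(A₀(Γ_{y,z}))φ^{(k)}(z)`.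
[cite: Balaban1983RegularityDecay, (4.8) p.590] -/
def firstOrder48 (c : X → X → ℝ) (m2 a : ℝ) (qin qout : Y → X → ℝ) (emb : Y → X) (Γ : Y → X → List X)
    (ak : ℝ) (A₀ A' : X → X → ℝ) (Ψ : Y × ι → ℝ) : ℝ :=
  2 * ∑ x, ∑ y, c x y * (κ * A' x y)
      * ((fieldLink (expFlow q hq) κ A₀ x y *ᵥ fld (phiK0 q hq κ c m2 a qin qout emb Γ ak A₀ Ψ) y
            - fld (phiK0 q hq κ c m2 a qin qout emb Γ ak A₀ Ψ) x)
          ⬝ᵥ (q *ᵥ fld (phiK0 q hq κ c m2 a qin qout emb Γ ak A₀ Ψ) x))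
    + 2 * a * ∑ y, fld (avgOp qin (contourTrans (fieldLink (expFlow q hq) κ A₀) emb Γ)
          *ᵥ phiK0 q hq κ c m2 a qin qout emb Γ ak A₀ Ψ) y
        ⬝ᵥ dAvg q hq κ qin emb Γ A₀ A' (phiK0 q hq κ c m2 a qin qout emb Γ ak A₀ Ψ) y
    - 2 * ak * ∑ y, fld Ψ y ⬝ᵥ dAvg q hq κ qout emb Γ A₀ A' (phiK0 q hq κ c m2 a qin qout emb Γ ak A₀ Ψ) y

omit [DecidableEq Y] in
/-- **THE ENVELOPE IDENTITY**: the raw derivative of the left side of (4.7) equals `⟨φ^{(k)}, Ḣφ^{(k)}⟩ −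
2a_k⟨φ, Q̇φ^{(k)}⟩` (only the symmetry of `G_k(Δ,A₀)` is used). [cite: Balaban1983RegularityDecay, (4.7)–(4.8) p.590] -/
theorem raw_eq_envelope (c : X → X → ℝ) (m2 a : ℝ) (qin qout : Y → X → ℝ) (emb : Y → X)
    (Γ : Y → X → List X) (ak : ℝ) (A₀ A' : X → X → ℝ) (Ψ : Y × ι → ℝ) :
    -(ak ^ 2 * (Ψ ⬝ᵥ ((avgOp qout (contourTrans (fieldLink (expFlow q hq) κ A₀) emb Γ)
          * b4Green (expFlow q hq) κ c m2 a qin emb Γ A₀ * (avgOp qout (dT q hq κ emb Γ A₀ A'))ᵀ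
        + (avgOp qout (contourTrans (fieldLink (expFlow q hq) κ A₀) emb Γ)
              * (-(b4Green (expFlow q hq) κ c m2 a qin emb Γ A₀ * dH q hq κ c a qin emb Γ A₀ A'
                    * b4Green (expFlow q hq) κ c m2 a qin emb Γ A₀))
            + avgOp qout (dT q hq κ emb Γ A₀ A') * b4Green (expFlow q hq) κ c m2 a qin emb Γ A₀)
          * (avgOp qout (contourTrans (fieldLink (expFlow q hq) κ A₀) emb Γ))ᵀ) *ᵥ Ψ)))
      = phiK0 q hq κ c m2 a qin qout emb Γ ak A₀ Ψ ⬝ᵥ (dH q hq κ c a qin emb Γ A₀ A'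
            *ᵥ phiK0 q hq κ c m2 a qin qout emb Γ ak A₀ Ψ)
        - 2 * ak * (Ψ ⬝ᵥ (avgOp qout (dT q hq κ emb Γ A₀ A') *ᵥ phiK0 q hq κ c m2 a qin qout emb Γ ak A₀ Ψ)) := by
  -- `G_k(Δ,A₀)` is symmetric (the operator (1.6) is: `−Δ_W = Σ c·DᵀD`, `P = QᵀQ`; cf. `B4Lemma22DualL1.b4Green_transpose`,
  -- stated there for colour types in `Type`)
  have hG : (b4Green (expFlow q hq) κ c m2 a qin emb Γ A₀)ᵀ = b4Green (expFlow q hq) κ c m2 a qin emb Γ A₀ := by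
    have hH : (b4Op (expFlow q hq) κ c m2 a qin emb Γ A₀)ᵀ = b4Op (expFlow q hq) κ c m2 a qin emb Γ A₀ := by
      unfold b4Op covOp projOp covLap
      simp only [Matrix.transpose_add, Matrix.transpose_sum, Matrix.transpose_smul, Matrix.transpose_mul,
        Matrix.transpose_transpose, Matrix.transpose_one]
    rw [b4Green, Matrix.transpose_nonsing_inv, hH]
  set Q := avgOp qout (contourTrans (fieldLink (expFlow q hq) κ A₀) emb Γ) with hQdef
  set dQ := avgOp qout (dT q hq κ emb Γ A₀ A') with hdQdef
  set G := b4Green (expFlow q hq) κ c m2 a qin emb Γ A₀ with hGdef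
  set Hd := dH q hq κ c a qin emb Γ A₀ A' with hHdef
  set v := Qᵀ *ᵥ Ψ with hv
  set w := dQᵀ *ᵥ Ψ with hw
  -- the three sandwich terms
  have h1 : Ψ ⬝ᵥ ((Q * G * dQᵀ) *ᵥ Ψ) = w ⬝ᵥ (G *ᵥ v) := by
    rw [sandwich, dotProduct_mulVec_of_symm hG]
  have h2 : Ψ ⬝ᵥ ((Q * (-(G * Hd * G)) * Qᵀ) *ᵥ Ψ) = -((G *ᵥ v) ⬝ᵥ (Hd *ᵥ (G *ᵥ v))) := by
    rw [sandwich, Matrix.neg_mulVec, dotProduct_neg, ← Matrix.mulVec_mulVec, ← Matrix.mulVec_mulVec,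
      dotProduct_mulVec_of_symm hG, dotProduct_comm]
  have h3 : Ψ ⬝ᵥ ((dQ * G * Qᵀ) *ᵥ Ψ) = w ⬝ᵥ (G *ᵥ v) := by
    rw [sandwich]
  have hsplit : Ψ ⬝ᵥ ((Q * G * dQᵀ + (Q * (-(G * Hd * G)) + dQ * G) * Qᵀ) *ᵥ Ψ)
      = w ⬝ᵥ (G *ᵥ v) + (-((G *ᵥ v) ⬝ᵥ (Hd *ᵥ (G *ᵥ v))) + w ⬝ᵥ (G *ᵥ v)) := by
    rw [Matrix.add_mulVec, dotProduct_add, h1, Matrix.add_mul, Matrix.add_mulVec, dotProduct_add, h2, h3]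
  -- the right side in the same letters
  have hphi : phiK0 q hq κ c m2 a qin qout emb Γ ak A₀ Ψ = ak • (G *ᵥ v) := rfl
  rw [hsplit, hphi, Matrix.mulVec_smul, dotProduct_smul, smul_dotProduct, Matrix.mulVec_smul, dotProduct_smul,
    smul_eq_mul, smul_eq_mul, smul_eq_mul]
  have h4 : Ψ ⬝ᵥ (dQ *ᵥ (G *ᵥ v)) = w ⬝ᵥ (G *ᵥ v) := by
    rw [Matrix.dotProduct_mulVec, ← Matrix.mulVec_transpose]
  rw [h4]
  ring

/-! ## §3. (4.8) IS THE FIRST-ORDER TERM OF THE LEFT SIDE OF (4.7) -/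

/-- **[B4] (4.8): THE DISPLAYED EXPRESSION IS THE FIRST-ORDER TERM OF THE LEFT SIDE OF (4.7)** (p. 590: *"We expand
the expression on the left hand side of (4.7) with respect to A′ … and we separate terms of first order in e. …
Denoting φ^{(k)} = a_kG_k(Δ(x,x′),A₀)Q_k^*(A₀)φ, we have the following expression (4.8)"*).  For the flow
`U = e^{tq}` of (1.2) with ANY antisymmetric `q`, any coupling `κ = eη`, bond weights `c`, mass `m²`, coefficient
`a`, inner/outer block weights, contour system, any constant (indeed arbitrary) background `A₀` at which the operator
(1.6) is invertible, any direction `A′` and any `φ = Ψ`: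
`d/dt|_{t=0} [a_k|φ|² − a_k²⟨φ, Q_k(A₀+tA′)G_k(Δ,A₀+tA′)Q_k^*(A₀+tA′)φ⟩] = firstOrder48` — the three printed lines.
Mechanism (kernel-checked): product rule with `Ġ = −GḢG`; the terms carrying the derivative of the minimiser cancel
because `G_k(Δ,A₀)` is symmetric (`raw_eq_envelope`); `⟨φ^{(k)}, Ḣφ^{(k)}⟩` is the first two lines (`dH_form`, the
first via «φ·qφ = 0 because q is an antisymmetric matrix», `bondDiff_dot_q`), `−2a_k⟨φ, Q̇φ^{(k)}⟩` the third.
[cite: Balaban1983RegularityDecay, (4.8) p.590] -/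
theorem hasDerivAt_lhs47 (c : X → X → ℝ) (m2 a : ℝ) (qin qout : Y → X → ℝ) (emb : Y → X)
    (Γ : Y → X → List X) (ak : ℝ) (A₀ A' : X → X → ℝ) (Ψ : Y × ι → ℝ)
    (hU : IsUnit (b4Op (expFlow q hq) κ c m2 a qin emb Γ A₀)) :
    HasDerivAt (fun t : ℝ => lhs47 (expFlow q hq) κ c m2 a qin qout emb Γ ak (A₀ + t • A') Ψ)
      (firstOrder48 q hq κ c m2 a qin qout emb Γ ak A₀ A' Ψ) 0 := by
  refine (hasDerivAt_lhs47_raw q hq κ c m2 a qin qout emb Γ ak A₀ A' Ψ hU).congr_deriv ?_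
  rw [raw_eq_envelope q hq, dH_form q hq, dotProduct_eq_sum_fld Ψ]
  simp_rw [fld_avgOp_dT_mulVec q hq]
  unfold firstOrder48
  ring

end Algebra

/-! ## §4. The instance of (4.7): [B4]'s fine region over a finite set of unit labels (the two-block region
`Δ(x,x′)` of `B4Ineq412ConstField.ineq412_constBond_gen` is `Ω = {y₀, y₀ + e_μ}`) at a CONSTANT background `A₀`,
where the operator (1.6) is invertible by (1.8) at `A = 0` and gauge covariance -/

section Instance

open Literature.MathematicalPhysics.QuantumFieldTheory.Balaban1983to89.B4Lower18
  (fineDom fineOpR fineOpR_isUnit fineOpR_mul_inv fineDom_isBlockUnion)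
open Literature.MathematicalPhysics.QuantumFieldTheory.Balaban1983to89.B4Ineq412ConstField
  (regWt blkWtR outWt scalarOp_fineDom)
open scoped Kronecker

variable {d : ℕ} {ι : Type*} [Fintype ι] [DecidableEq ι]

/-- **THE OPERATOR (1.6) AT A CONSTANT FIELD IS INVERTIBLE** on the fine region of any finite set of unit labels
(`a > 0`, `m² ≥ 0`): `H(A₀) = 𝒢(H_scalar ⊗ 1)𝒢ᵀ` (`B4GaugeCovariance.b4Op_constBond`) with `H_scalar =
B4Lower18.fineOpR` invertible by (1.8) at `A = 0` (`B4Lower18.fineOpR_isUnit`). [cite: Balaban1983RegularityDecay, (1.8) p.573 with p.581 «equivalent to the case of configuration A₀ = 0»] -/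
theorem isUnit_b4Op_constBond_fineDom {n : ℕ} (hn : 1 ≤ n) {a m2 : ℝ} (ha : 0 < a) (hm : 0 ≤ m2)
    (Ω : Finset (Fin (d + 1) → ℤ)) (F : OrthFlow ι) (κ : ℝ) {emb : ↥Ω → ↥(fineDom n Ω)}
    {Γ : ↥Ω → ↥(fineDom n Ω) → List ↥(fineDom n Ω)}
    (hend : ∀ y x, blkWtR n Ω y x ≠ 0 → pathEnd (emb y) (Γ y x) = x) (A₀ : Fin (d + 1) → ℝ) :
    IsUnit (b4Op F κ (regWt n Ω) m2 (a * ((n : ℝ) ^ (d + 1))⁻¹) (blkWtR n Ω) emb Γ (constBond A₀ Subtype.val)) := by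
  rw [b4Op_constBond F κ _ m2 _ hend, scalarOp_fineDom hn, Matrix.isUnit_iff_isUnit_det]
  set S := fineOpR n a m2 (fineDom n Ω)
  set g : Matrix (↥(fineDom n Ω) × ι) (↥(fineDom n Ω) × ι) ℝ :=
    blockDiag fun u => F.U (κ * linGauge A₀ Subtype.val u)
  have hg : IsGauge fun u : ↥(fineDom n Ω) => F.U (κ * linGauge A₀ Subtype.val u) := F.isGauge _
  have hpos : 0 < min 2 a + m2 := add_pos_of_pos_of_nonneg (lt_min two_pos ha) hm
  have hS : S * S⁻¹ = 1 := fineOpR_mul_inv hn ha.le hpos (fineDom_isBlockUnion hn Ω)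
  refine Matrix.isUnit_det_of_right_inverse (B := g * (S⁻¹ ⊗ₖ (1 : Matrix ι ι ℝ)) * gᵀ) ?_
  have hgg : gᵀ * g = 1 := blockDiag_transpose_mul_self hg
  calc g * (S ⊗ₖ (1 : Matrix ι ι ℝ)) * gᵀ * (g * (S⁻¹ ⊗ₖ (1 : Matrix ι ι ℝ)) * gᵀ)
      = g * (S ⊗ₖ (1 : Matrix ι ι ℝ)) * (gᵀ * g) * (S⁻¹ ⊗ₖ (1 : Matrix ι ι ℝ)) * gᵀ := by
        simp only [Matrix.mul_assoc]
    _ = g * ((S * S⁻¹) ⊗ₖ (1 : Matrix ι ι ℝ)) * gᵀ := by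
        rw [hgg, Matrix.mul_one, Matrix.mul_assoc g, ← Matrix.mul_kronecker_mul, Matrix.mul_one]
    _ = 1 := by rw [hS, Matrix.one_kronecker_one, Matrix.mul_one, blockDiag_mul_transpose_self hg]

/-- **(4.8) FOR THE LEFT SIDE OF (4.7) AS TYPED IN `B4Ineq412ConstField`** (fine region `⋃_{y∈Ω}B^k(y)` of any finite
set `Ω` of unit labels — the two-block `Δ(x,x′)` is `Ω = {y₀, y₀ + e_μ}` = `B4Ineq412ConstField.pair y₀ μ` — with
[B4]'s weights `regWt`/`blkWtR`/`outWt`, coefficient `a_k·n^{−(d+1)}`, prefactor `a_k`, any block embedding and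
admissible contour system, the flow `e^{tq}` of (1.2), a CONSTANT background `A₀` and any direction `A′`):
`d/dt|₀ lhs47(A₀ + tA′, φ) = firstOrder48(A₀, A′, φ)` — hypothesis-free (the invertibility comes from (1.8)).
[cite: Balaban1983RegularityDecay, (4.7)–(4.8) p.590] -/
theorem hasDerivAt_lhs47_fineDom {n : ℕ} (hn : 1 ≤ n) {a m2 : ℝ} (ha : 0 < a) (hm : 0 ≤ m2)
    (Ω : Finset (Fin (d + 1) → ℤ)) (q : Matrix ι ι ℝ) (hq : qᵀ = -q) (κ : ℝ) {emb : ↥Ω → ↥(fineDom n Ω)}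
    {Γ : ↥Ω → ↥(fineDom n Ω) → List ↥(fineDom n Ω)}
    (hend : ∀ y x, blkWtR n Ω y x ≠ 0 → pathEnd (emb y) (Γ y x) = x) (A₀ : Fin (d + 1) → ℝ)
    (A' : ↥(fineDom n Ω) → ↥(fineDom n Ω) → ℝ) (Ψ : ↥Ω × ι → ℝ) :
    HasDerivAt (fun t : ℝ => lhs47 (expFlow q hq) κ (regWt n Ω) m2 (a * ((n : ℝ) ^ (d + 1))⁻¹) (blkWtR n Ω)
        (outWt n Ω) emb Γ a (constBond A₀ Subtype.val + t • A') Ψ)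
      (firstOrder48 q hq κ (regWt n Ω) m2 (a * ((n : ℝ) ^ (d + 1))⁻¹) (blkWtR n Ω) (outWt n Ω) emb Γ a
        (constBond A₀ Subtype.val) A' Ψ) 0 :=
  hasDerivAt_lhs47 q hq κ _ m2 _ _ _ emb Γ a _ A' Ψ
    (isUnit_b4Op_constBond_fineDom hn ha hm Ω (expFlow q hq) κ hend A₀)

end Instance

end

end Literature.MathematicalPhysics.QuantumFieldTheory.Balaban1983to89.B4Eq48FirstOrder
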